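import Summits.BirchSwinnertonDyer.Rank1Residual.Additive.SemistableTwistAnalyticOdd
import Summits.BirchSwinnertonDyer.Rank1Residual.Additive.X3RankZeroSemistableTwist
import Summits.BirchSwinnertonDyer.Rank1Residual.Additive.RamifiedTwistMinimality
import HarnessLib

/-!
# X3 ∧ `r_an = 0` ∧ (semistable twist), `p ≡ 3 (mod 4)`: `ord_p #Ш(E) ≤ ord_p #Ш_an(E) + ord_p c_p(E)` from the typed ODD `χ`-branch input (cell `b2b-bsdres`, seat additive-p4, line V9)

HONEST FRAMING (cell `b2b-bsdres`, run/shared/lean/b2b/bsd-rank1-residual/, verbatim in every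
file): the goal of the cell is to DELETE the COMBINATION-SHAPED residual classes of the
Birch–Swinnerton-Dyer formula for ALL analytic-rank `≤ 1` elliptic curves over `ℚ` — "full BSD
formula for every rank `≤ 1` curve in class `C`" assembled STRICTLY from published theorems — so
that the rank-`≤ 1` remainder becomes exactly the CONSTRUCTION-SHAPED classes, which are TYPED
(missing-input `Prop`s), NOT attempted. This is not "finishing BSD". The additive sub-cell (seats
additive-p1…p4) is a RESEARCH ROUTE on the construction-shaped classes X3/X4; no claim beyond the
stated classes; the label of X3 is UNCHANGED (its one non-published input is TYPED).

Theorems only (no definition, no new named fact). Odd twin of `X3RankZeroSemistableTwist.lean`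
(p203525) — the primes `p ≡ 3 (mod 4)` (`p = 3, 7, …`), which carry 757 of the 818 pairs of the V9
domain X3 ∧ [(M) ∪ (G-ord, e = 2)] (HOME/b2b-bsdres-additive-p4/V9-CHAIN.md). Setting: `E = W/ℚ`
globally minimal, class X3 at `p` (`E[p]` reducible, additive), analytic rank `0`,
`W = C • V^{(−p)}` for a globally minimal `V = E♭` GOOD ORDINARY (`I₀*`) or MULTIPLICATIVE (`I_n*`)
at `p` (so `ord_p u(C) = 0`: `V^{(−p)}` is `p`-minimal, `RamifiedTwistMinimality.lean`), `f` the
newform of `V`, `ϖ⁻ · |Ω⁻(V)| = Ω⁻_f`.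

* `X3RankZeroTwistOdd.shaOrder_le_of_leadingTerm` / `.shaOrder_le` (typed-input form): with
  [A] Delbourgo 1998 Prop. 4 (`hDel`, p202678), the typed ODD input [B∘C](0)
  (`ChiBranchLeadingTermOddAt`, p203717: some `g ∈ char X(E/ℚ_∞)` has
  `g(0) = u·ϖ⁻·∑(a/p)[a/p]⁻_f`), the analytic side of `SemistableTwistAnalyticOdd.lean`
  (`L(E,1) = ±ϖ⁻·(∑…)·Ω_E/(|u(C)|·c_∞)`, odd Birch + Pal `d < 0`, both PROVED in the tree),
  Gross–Zagier–Kolyvagin (`hGZK`) and modularity (`hmod`): `#Ш_an(E) = q ∈ ℚ` with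
  **`ord_p #Ш(E) ≤ ord_p q + ord_p c_p(E)`** — the torsion terms cancel, `∏_{ℓ≠p} c_ℓ` cancels,
  `c_∞, u(C)` are `p`-units; only `c_p(E) ∈ {1,2,3,4}` (Kodaira–Néron) survives, and it is a
  `p`-unit unless `p = 3 ∣ c_3(E)` (which the Kodaira types `I₀*`/`I_n*` exclude; per-pair bit).
* `X3RankZeroTwistOdd.missingUpperBoundAt` (`p ∤ c_p(E)`) and `…_of_ne_three` (`p ≥ 7`: automatic):
  **`Typed.MissingUpperBoundAt W p`**; `X3RankZeroTwistOdd.bsdp_of_shaAn_unit`: **`BSD(E,p)` on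
  the rows with `p ∤ #Ш_an(E)`**; `X3RankZeroTwistOdd.missingPPartAt_iff_lower`.
Compared with the even case NO period fact is assumed (Pal's theorem is proved in the tree for
`d < 0`); the named facts are `hDel`, `hGZK`, `hmod` and the typed [B∘C](0).

References: Delbourgo 1998 [Delbourgo1998] Thm. 3, Prop. 4; Wuthrich 2014 [Wuthrich2014] Thm. 16;
Mazur–Tate–Teitelbaum 1986 [MazurTateTeitelbaum1986Invent] §I.8, §I.14; Pal 2012 [Pal2012]
Thm. 3.2; Miller 2011 [Miller2011LMS] Def. 1.1; Silverman *ATAEC* IV.9.2 (Kodaira–Néron).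
-/

noncomputable section

open scoped Classical MatrixGroups ModularForm

open CongruenceSubgroup WeierstrassCurve Literature.NumberTheory.EllipticCurves
  Literature.NumberTheory.EllipticCurves.ModularForms
  Literature.NumberTheory.EllipticCurves.Rank1Residual

namespace Summit.BirchSwinnertonDyer.Rank1Residual.Additive

/-! ## The odd assembly on X3 ∧ `r_an = 0` ∧ (semistable twist), `p ≡ 3 (mod 4)` -/

section AssemblyOdd

open IsDedekindDomain NumberField Rat.HeightOneSpectrum
  Literature.NumberTheory.EllipticCurves.Rank1Residual.Typed

variable (W : WeierstrassCurve ℚ) [W.IsElliptic] [W.IsGloballyMinimal] (p : ℕ) [hp : Fact p.Prime]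

/-- Delbourgo's hypothesis "(G)-ordinary or (M)" for `E = W ≅ V ⊗ χ_{−p}` from the twist datum
(`p ≡ 3 (mod 4)`, `p* = −p`): good ordinary twist ⇒ (G)-ordinary (additive-p2's
`typeGOrd_of_goodOrd_quadraticTwist`), multiplicative twist ⇒ `ord_p j(E) = ord_p j(V) < 0`. -/
theorem typeGOrd_or_padicValRat_j_neg_of_twist_neg (hp4 : p % 4 = 3)
    (V : WeierstrassCurve ℚ) [V.IsElliptic] [V.IsGloballyMinimal]
    (hVW : ∃ C : VariableChange ℚ, C • V.quadraticTwist (-(p : ℚ)) = W)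
    (hV : GoodOrd V p ∨ Mult V p) : TypeGOrd W p ∨ padicValRat p W.j < 0 := by
  have hp2 : p ≠ 2 := by omega
  have hp0 : (-(p : ℚ)) ≠ 0 := neg_ne_zero.mpr (by exact_mod_cast hp.out.ne_zero)
  rcases hV with hord | hmult
  · left
    obtain ⟨C₀, hC₀⟩ := exists_variableChange_quadraticTwist_symm W V hp0 hVW
    have hpstar : ((-1 : ℚ) ^ (p / 2) * p) = -(p : ℚ) := by
      have h := neg_one_pow_half_eq_neg_one_of_mod_four_eq_three p hp4
      have h' : ((-1 : ℚ) ^ (p / 2)) = (((-1 : ℤ) ^ (p / 2) : ℤ) : ℚ) := by push_cast; ring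
      rw [h', h]
      push_cast
      ring
    refine typeGOrd_of_goodOrd_quadraticTwist W p hp2 V C₀ ?_ hord
    rw [hpstar]
    exact hC₀
  · right
    obtain ⟨C, hC⟩ := hVW
    haveI := V.isElliptic_quadraticTwist (d := -(p : ℚ)) hp0
    have hj : W.j = V.j := by
      subst hC
      rw [variableChange_j, V.j_quadraticTwist hp0]
    rw [hj]
    exact EisensteinPrimes.padicValRat_j_neg_of_mult V p hmult

omit [W.IsElliptic] [W.IsGloballyMinimal] in
/-- `ord_p c_∞ = 0`: the number of real components is `1` or `2`, a `p`-adic unit at odd `p`. -/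
theorem padicValRat_numRealComponents_eq_zero (hp2 : p ≠ 2) :
    padicValRat p (((W.baseChange ℝ).numRealComponents : ℕ) : ℚ) = 0 := by
  rw [padicValRat.of_nat, Nat.cast_eq_zero, numRealComponents]
  split_ifs
  · exact padicValNat.eq_zero_of_not_dvd fun h ↦ hp2 ((Nat.prime_dvd_prime_iff_eq hp.out Nat.prime_two).mp h)
  · simp

/-- **Core theorem (line V9, rank 0, `p ≡ 3 (mod 4)`).** Let `E = W` be a globally minimal elliptic
curve over `ℚ` of analytic rank `0` in class X3 at `p ≡ 3 (mod 4)` (`E[p]` reducible, `E` additive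
at `p`), equal to `C • V^{(−p)}` for a globally minimal `V = E♭` good ordinary or multiplicative at
`p`, with `u(C)` a `p`-adic unit (hypothesis `hu` of this core form; automatic — `V^{(−p)}` is
already `p`-minimal, `padicValRat_u_eq_zero_of_twist_pm_p`, used by the corollaries below), `f`
the newform of `V`, `ϖ⁻ · |Ω⁻(V)| = Ω⁻_f`. ASSUME the typed odd input [B∘C](0) (`hLT`). THEN, from
Delbourgo 1998 Prop. 4 (`hDel`, p202678), the ODD Birch formula and Pal 2012 Thm. 3.2 (`d < 0`)
— both PROVED in the tree —, Kodaira–Néron, Gross–Zagier–Kolyvagin (`hGZK`) and modularity (`hmod`):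
`#Ш_an(E)` is a rational `q` with **`ord_p #Ш(E) ≤ ord_p q + ord_p c_p(E)`** (`c_p(E) ∈ {1,2,3,4}`;
`= ord_p q` unless `p = 3 ∣ c_3(E)`, which does not happen for Kodaira types `I₀*`, `I_n*`). -/
theorem X3RankZeroTwistOdd.shaOrder_le_of_leadingTerm
    (hDel : Delbourgo1998.prop4_rankZero_pow_dvd_constantCoeff)
    (hGZK : rank_eq_analyticRank_of_analyticRank_le_one) (hmod : hasEntireLFunction_rat)
    (hp4 : p % 4 = 3) (hr : W.analyticRank = 0) (hX : ClassX3 W p)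
    (V : WeierstrassCurve ℚ) [V.IsElliptic] [V.IsGloballyMinimal]
    (C : VariableChange ℚ) (hC : C • V.quadraticTwist (-(p : ℚ)) = W) (hV : GoodOrd V p ∨ Mult V p)
    (hu : padicValRat p (C.u : ℚ) = 0)
    {N : ℕ} [NeZero N] {f : CuspForm (Gamma0 N) 2} (hf : IsNewformOf V f)
    (ϖ : ℚ) (hϖ : (ϖ : ℝ) * V.imaginaryPeriodRat = minusPeriod f)
    (hLT : ∀ (κ : ZpExtension ℚ p) (γ : Field.absoluteGaloisGroup ℚ),
      κ.IsCyclotomic → κ.IsTopGenerator γ → IsCyclotomicVariable p γ →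
      ∀ D : W.SelmerDualData κ γ, ∃ g ∈ D.charIdeal, ∃ u : ℤ_[p]ˣ,
        ((PowerSeries.constantCoeff g : ℤ_[p]) : ℚ_[p]) =
          ((u : ℤ_[p]) : ℚ_[p]) * (ϖ : ℚ_[p]) * (legendreMinusSymbolSum f p : ℚ_[p])) :
    ∃ q : ℚ, shaAn W = (q : ℂ) ∧
      (padicValNat p W.shaOrder : ℤ) ≤
        padicValRat p q + padicValNat p (W.tamagawaNumberAt ((primesEquiv (R := 𝓞 ℚ)).symm ⟨p, hp.out⟩)) := by
  classical
  have hpP : p.Prime := hp.out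
  have hp2 : p ≠ 2 := by omega
  set v₀ : HeightOneSpectrum (𝓞 ℚ) := (primesEquiv (R := 𝓞 ℚ)).symm ⟨p, hp.out⟩ with hv₀
  -- rank 0: `L(E,1) ≠ 0`, `E(ℚ)` and `Ш` finite
  have hL : W.entireLFunction 1 ≠ 0 := (W.analyticRank_eq_zero_iff_holds (hmod W)).mp hr
  obtain ⟨hmw, hfin⟩ := hGZK W (by rw [hr]; exact zero_le_one)
  have hmw0 : W.mordellWeilRank = 0 := by rw [hmw, hr]
  haveI : Finite W.sha := hfin
  haveI hE : Finite W.toAffine.Point := W.finite_point_of_rank_zero hmw0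
  -- the cyclotomic setting and `X(E/ℚ_∞)`
  obtain ⟨κ, hκ, γ, hγ, hγ'⟩ := exists_isCyclotomic_isTopGenerator_isCyclotomicVariable_holds p
  obtain ⟨D⟩ := W.nonempty_selmerDualData_holds κ γ hγ
  -- [B∘C](0), odd branch
  obtain ⟨g, hgmem, u, hg0⟩ := hLT κ γ hκ hγ hγ' D
  -- [A]: Delbourgo 1998 Prop. 4
  have hGM := typeGOrd_or_padicValRat_j_neg_of_twist_neg W p hp4 V ⟨C, hC⟩ hV
  obtain ⟨-, hdiv⟩ := hDel W p hp2 hX.2 hGM hr hfin hE κ γ hκ hγ D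
  have hdvd := hdiv g hgmem
  -- [E⁻] + [F] + odd Birch
  obtain ⟨ε, hε, hLq⟩ := entireLFunction_one_eq_of_twist_neg p hmod hp4 V W C hC hX.2 hf ϖ hϖ
  set S : ℚ := legendreMinusSymbolSum f p with hS
  set cinf : ℕ := (W.baseChange ℝ).numRealComponents with hcinf
  set q : ℚ := ε * (ϖ * S) / (|(C.u : ℚ)| * (cinf : ℚ)) with hq
  have hΩ : (W.realPeriodRat : ℂ) ≠ 0 := by exact_mod_cast W.realPeriodRat_pos_holds.ne'
  have hq' : W.entireLFunction 1 / (W.realPeriodRat : ℂ) = (q : ℂ) := by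
    rw [hLq, mul_div_cancel_right₀ _ hΩ]
  obtain ⟨-, -, -, hshaAn⟩ := Wuthrich2014.shaAn_eq_of_L_one_div_eq hGZK W hL hq'
  -- non-vanishing and the valuation of `q`
  have hua0 : |(C.u : ℚ)| ≠ 0 := abs_ne_zero.mpr C.u.ne_zero
  have hcinf0 : (cinf : ℚ) ≠ 0 := by
    rw [hcinf, numRealComponents]
    split_ifs <;> norm_num
  have hden0 : |(C.u : ℚ)| * (cinf : ℚ) ≠ 0 := mul_ne_zero hua0 hcinf0
  have hϖS : ϖ * S ≠ 0 := by
    intro h0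
    apply hL
    rw [hLq, hq, h0, mul_zero, zero_div, Rat.cast_zero, zero_mul]
  have hε0 : ε ≠ 0 := by rcases hε with h | h <;> rw [h] <;> norm_num
  have hq0 : q ≠ 0 := by
    rw [hq]
    exact div_ne_zero (mul_ne_zero hε0 hϖS) hden0
  have hvε : padicValRat p ε = 0 := by
    rcases hε with h | h
    · rw [h, padicValRat.one]
    · rw [h, padicValRat.neg, padicValRat.one]
  have hvua : padicValRat p |(C.u : ℚ)| = 0 := by
    rcases abs_choice (C.u : ℚ) with h | h
    · rw [h, hu]
    · rw [h, padicValRat.neg, hu]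
  have hvq : padicValRat p q = padicValRat p (ϖ * S) := by
    rw [hq, padicValRat.div (mul_ne_zero hε0 hϖS) hden0, padicValRat.mul hε0 hϖS,
      padicValRat.mul hua0 hcinf0, hvε, hvua, padicValRat_numRealComponents_eq_zero W p hp2]
    ring
  -- names for the arithmetic quantities
  set T : ℕ := Nat.card W.toAffine.Point with hT
  set c : ℕ := W.tamagawaNumberAt v₀ with hc
  set P' : ℕ := ∏ᶠ v : HeightOneSpectrum (𝓞 ℚ),
    (if (p : 𝓞 ℚ) ∈ v.asIdeal then 1 else W.tamagawaNumberAt v) with hP'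
  have hT0 : T ≠ 0 := by rw [hT]; exact Nat.card_pos.ne'
  have hPsplit : W.tamagawaProduct = c * P' := tamagawaProduct_eq_tamagawaNumberAt_mul_finprod W p
  have hPpos : 0 < W.tamagawaProduct := W.tamagawaProduct_pos_holds
  have hc0 : c ≠ 0 := fun h ↦ by rw [hPsplit, h, zero_mul] at hPpos; exact lt_irrefl 0 hPpos
  have hP'0 : P' ≠ 0 := fun h ↦ by rw [hPsplit, h, mul_zero] at hPpos; exact lt_irrefl 0 hPpos
  have hvP : padicValNat p W.tamagawaProduct = padicValNat p c + padicValNat p P' := by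
    rw [hPsplit, padicValNat.mul hc0 hP'0]
  have hsha : padicValNat p (Nat.card (AddCommGroup.primaryComponent W.sha p)) =
      padicValNat p W.shaOrder := by
    unfold WeierstrassCurve.shaOrder
    exact padicValNat_card_addPrimaryComponent p
  -- the divisibility in `ℤ_p`, read as an inequality of valuations in `ℚ_p`
  set g0 : ℚ_[p] := ((PowerSeries.constantCoeff g : ℤ_[p]) : ℚ_[p]) with hg0def
  have hg0S : g0 = ((u : ℤ_[p]) : ℚ_[p]) * ((ϖ * S : ℚ) : ℚ_[p]) := by
    rw [hg0]
    push_cast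
    ring
  have hϖSQ : ((ϖ * S : ℚ) : ℚ_[p]) ≠ 0 := by exact_mod_cast hϖS
  have hg0ne : g0 ≠ 0 := by
    rw [hg0S]
    exact mul_ne_zero (coe_units_ne_zero p u) hϖSQ
  have hvg0 : g0.valuation = padicValRat p (ϖ * S) := by
    rw [hg0S, Padic.valuation_mul (coe_units_ne_zero p u) hϖSQ, valuation_coe_units_eq_zero,
      zero_add, Padic.valuation_ratCast]
  have hTQ : ((T : ℕ) : ℚ_[p]) ≠ 0 := by exact_mod_cast hT0
  obtain ⟨c', hc'⟩ := hdvd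
  have hkey : g0 * ((T : ℕ) : ℚ_[p]) ^ 2 =
      (p : ℚ_[p]) ^ (padicValNat p (Nat.card (AddCommGroup.primaryComponent W.sha p)) +
        padicValNat p P') * ((c' : ℤ_[p]) : ℚ_[p]) := by
    have h := congrArg ((↑) : ℤ_[p] → ℚ_[p]) hc'
    push_cast at h
    rw [hg0def]
    exact h
  have hlhs0 : g0 * ((T : ℕ) : ℚ_[p]) ^ 2 ≠ 0 := mul_ne_zero hg0ne (pow_ne_zero 2 hTQ)
  have hc'0 : ((c' : ℤ_[p]) : ℚ_[p]) ≠ 0 := by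
    intro h0
    rw [h0, mul_zero] at hkey
    exact hlhs0 hkey
  have hpQ : (p : ℚ_[p]) ≠ 0 := by exact_mod_cast hpP.ne_zero
  have hval := congrArg Padic.valuation hkey
  rw [Padic.valuation_mul hg0ne (pow_ne_zero 2 hTQ), Padic.valuation_pow, Padic.valuation_natCast,
    hvg0, Padic.valuation_mul (pow_ne_zero _ hpQ) hc'0, Padic.valuation_pow, Padic.valuation_p,
    mul_one, hsha] at hval
  have hc'val : 0 ≤ (((c' : ℤ_[p]) : ℚ_[p])).valuation := PadicInt.valuation_coe_nonneg
  have hineq : (padicValNat p W.shaOrder : ℤ) + padicValNat p P' ≤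
      padicValRat p (ϖ * S) + 2 * (padicValNat p T : ℤ) := by
    simp only [Nat.cast_add, Nat.cast_ofNat] at hval
    linarith
  -- conclusion
  refine ⟨q * (T : ℚ) ^ 2 / (W.tamagawaProduct : ℚ), ?_, ?_⟩
  · rw [hshaAn]
  · have hTq : (T : ℚ) ≠ 0 := by exact_mod_cast hT0
    have hPq : (W.tamagawaProduct : ℚ) ≠ 0 := by exact_mod_cast hPpos.ne'
    rw [padicValRat.div (mul_ne_zero hq0 (pow_ne_zero 2 hTq)) hPq,
      padicValRat.mul hq0 (pow_ne_zero 2 hTq), padicValRat.pow, padicValRat.of_nat,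
      padicValRat.of_nat, hvq, hvP]
    simp only [Nat.cast_ofNat, Nat.cast_add]
    linarith

/-- **X3 ∧ `r_an = 0` ∧ (semistable twist) at `p ≡ 3 (mod 4)`, typed-input form**: granted
`ChiBranchLeadingTermOddAt W p` ([B∘C] at `T = 0`, odd branch), for `E = W = C • V^{(−p)}` with
`V` good ordinary (`I₀*`) or multiplicative (`I_n*`) at `p` and `ord_p u(C) = 0`, `#Ш_an(E)` is a
rational `q` with `ord_p #Ш(E) ≤ ord_p q + ord_p c_p(E)` — from Delbourgo 1998 Prop. 4 (`hDel`),
Gross–Zagier–Kolyvagin (`hGZK`), modularity (`hmod`) and tree theorems only (odd Birch, Pal `d < 0`,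
Kodaira–Néron). No period fact is assumed. -/
theorem X3RankZeroTwistOdd.shaOrder_le
    (hDel : Delbourgo1998.prop4_rankZero_pow_dvd_constantCoeff)
    (hGZK : rank_eq_analyticRank_of_analyticRank_le_one) (hmod : hasEntireLFunction_rat)
    (hBC : ChiBranchLeadingTermOddAt W p)
    (hp4 : p % 4 = 3) (hr : W.analyticRank = 0) (hX : ClassX3 W p)
    (V : WeierstrassCurve ℚ) [V.IsElliptic] [V.IsGloballyMinimal]
    (C : VariableChange ℚ) (hC : C • V.quadraticTwist (-(p : ℚ)) = W) (hV : GoodOrd V p ∨ Mult V p)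
    {N : ℕ} [NeZero N] {f : CuspForm (Gamma0 N) 2} (hf : IsNewformOf V f)
    (ϖ : ℚ) (hϖ : (ϖ : ℝ) * V.imaginaryPeriodRat = minusPeriod f) :
    ∃ q : ℚ, shaAn W = (q : ℂ) ∧
      (padicValNat p W.shaOrder : ℤ) ≤
        padicValRat p q + padicValNat p (W.tamagawaNumberAt ((primesEquiv (R := 𝓞 ℚ)).symm ⟨p, hp.out⟩)) := by
  -- `ord_p u(C) = 0`: the twisted model `V^{(−p)}` is already `p`-minimal (Pal's `u_p = 1`, proved)
  have hC' : C • V.quadraticTwist (((-(p : ℤ)) : ℤ) : ℚ) = W := by push_cast; exact hC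
  have hu : padicValRat p (C.u : ℚ) = 0 :=
    padicValRat_u_eq_zero_of_twist_pm_p p (by omega) V W (hV.elim (fun h ↦ Or.inl h.1) Or.inr)
      (Or.inr rfl) C hC'
  exact X3RankZeroTwistOdd.shaOrder_le_of_leadingTerm W p hDel hGZK hmod hp4 hr hX V C hC hV hu hf ϖ
    hϖ fun _ _ hκ hγ hγ' D ↦ (hBC V hp4 ⟨C, hC⟩ hV hX.1 hκ hγ hγ' hf D ϖ hϖ).2

/-- **The typed UPPER half `ord_p #Ш(E) ≤ ord_p #Ш_an(E)` at `p ≡ 3 (mod 4)`** whenever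
`p ∤ c_p(E)` — automatic for `p ≥ 7` (`c_p ≤ 4`), and at `p = 3` the census bit
`c_3(E) ∈ {1, 2, 4}` (always the case for the Kodaira types `I₀*`, `I_n*` of a twist of a
semistable curve; not re-proved here). -/
theorem X3RankZeroTwistOdd.missingUpperBoundAt
    (hDel : Delbourgo1998.prop4_rankZero_pow_dvd_constantCoeff)
    (hGZK : rank_eq_analyticRank_of_analyticRank_le_one) (hmod : hasEntireLFunction_rat)
    (hBC : ChiBranchLeadingTermOddAt W p)
    (hp4 : p % 4 = 3) (hr : W.analyticRank = 0) (hX : ClassX3 W p)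
    (V : WeierstrassCurve ℚ) [V.IsElliptic] [V.IsGloballyMinimal]
    (C : VariableChange ℚ) (hC : C • V.quadraticTwist (-(p : ℚ)) = W) (hV : GoodOrd V p ∨ Mult V p)
    {N : ℕ} [NeZero N] {f : CuspForm (Gamma0 N) 2} (hf : IsNewformOf V f)
    (ϖ : ℚ) (hϖ : (ϖ : ℝ) * V.imaginaryPeriodRat = minusPeriod f)
    (htam : ¬ p ∣ W.tamagawaNumberAt ((primesEquiv (R := 𝓞 ℚ)).symm ⟨p, hp.out⟩)) :
    MissingUpperBoundAt W p := by
  obtain ⟨q, hq, hle⟩ :=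
    X3RankZeroTwistOdd.shaOrder_le W p hDel hGZK hmod hBC hp4 hr hX V C hC hV hf ϖ hϖ
  refine ⟨q, hq, ?_⟩
  rw [padicValNat.eq_zero_of_not_dvd htam, Nat.cast_zero, add_zero] at hle
  exact hle

/-- At `p ≡ 3 (mod 4)` with `p ≠ 3` (so `p ≥ 7`) the Tamagawa hypothesis is automatic
(`c_p(E) ≤ 4 < p`): **`ord_p #Ш(E) ≤ ord_p #Ш_an(E)`** on X3 ∧ `r_an = 0` ∧ (semistable twist),
granted [B∘C](0) (odd branch). -/
theorem X3RankZeroTwistOdd.missingUpperBoundAt_of_ne_three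
    (hDel : Delbourgo1998.prop4_rankZero_pow_dvd_constantCoeff)
    (hGZK : rank_eq_analyticRank_of_analyticRank_le_one) (hmod : hasEntireLFunction_rat)
    (hBC : ChiBranchLeadingTermOddAt W p)
    (hp4 : p % 4 = 3) (hp3 : p ≠ 3) (hr : W.analyticRank = 0) (hX : ClassX3 W p)
    (V : WeierstrassCurve ℚ) [V.IsElliptic] [V.IsGloballyMinimal]
    (C : VariableChange ℚ) (hC : C • V.quadraticTwist (-(p : ℚ)) = W) (hV : GoodOrd V p ∨ Mult V p)
    {N : ℕ} [NeZero N] {f : CuspForm (Gamma0 N) 2} (hf : IsNewformOf V f)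
    (ϖ : ℚ) (hϖ : (ϖ : ℝ) * V.imaginaryPeriodRat = minusPeriod f) :
    MissingUpperBoundAt W p := by
  have hp5 : 5 ≤ p := by
    have h2 := hp.out.two_le
    by_contra h
    interval_cases p <;> simp_all
  refine X3RankZeroTwistOdd.missingUpperBoundAt W p hDel hGZK hmod hBC hp4 hr hX V C hC hV hf ϖ hϖ ?_
  have h0 := padicValNat_tamagawaNumberAt_eq_zero_of_addv W p hX.2 hp5
  obtain ⟨hc0, hc4⟩ := tamagawaNumberAt_ne_zero_and_le_four_of_addv W p hX.2
  exact fun h ↦ hc0 (Nat.eq_zero_of_dvd_of_lt h (by omega))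

/-- **`BSD(E,p)` on the `p`-unit rows, `p ≡ 3 (mod 4)`** (granted [B∘C](0), odd branch): if
`p ∤ c_p(E)` and `#Ш_an(E)` is a `p`-adic unit then `ord_p #Ш(E) = 0 = ord_p #Ш_an(E)`, i.e.
Miller's `BSD(E,p)` — the 757 `p ≡ 3 (mod 4)` pairs of the V9 domain are the bulk of the rank-`0`
X3 (M)/(G-ord, e = 2) census; the per-row bits (`p ∤ #Ш_an`, `c_p ∈ {1,2,4}`) are the lane's. -/
theorem X3RankZeroTwistOdd.bsdp_of_shaAn_unit
    (hDel : Delbourgo1998.prop4_rankZero_pow_dvd_constantCoeff)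
    (hGZK : rank_eq_analyticRank_of_analyticRank_le_one) (hmod : hasEntireLFunction_rat)
    (hBC : ChiBranchLeadingTermOddAt W p)
    (hp4 : p % 4 = 3) (hr : W.analyticRank = 0) (hX : ClassX3 W p)
    (V : WeierstrassCurve ℚ) [V.IsElliptic] [V.IsGloballyMinimal]
    (C : VariableChange ℚ) (hC : C • V.quadraticTwist (-(p : ℚ)) = W) (hV : GoodOrd V p ∨ Mult V p)
    {N : ℕ} [NeZero N] {f : CuspForm (Gamma0 N) 2} (hf : IsNewformOf V f)
    (ϖ : ℚ) (hϖ : (ϖ : ℝ) * V.imaginaryPeriodRat = minusPeriod f)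
    (htam : ¬ p ∣ W.tamagawaNumberAt ((primesEquiv (R := 𝓞 ℚ)).symm ⟨p, hp.out⟩))
    {q : ℚ} (hq : shaAn W = (q : ℂ)) (hv : padicValRat p q = 0) : BSDp W p :=
  bsdp_of_missingPPartAt W p hGZK (by rw [hr]; exact zero_le_one)
    (missingPPartAt_of_upper_of_shaAn_unit W p
      (X3RankZeroTwistOdd.missingUpperBoundAt W p hDel hGZK hmod hBC hp4 hr hX V C hC hV hf ϖ hϖ
        htam) hq hv)

/-- **What remains of X3♯ on these pairs is the LOWER half** (`p ≡ 3 (mod 4)`, `p ∤ c_p(E)`),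
granted [B∘C](0): `Typed.X3.MissingInputAt W p ⟺ MissingLowerBoundAt W p`. -/
theorem X3RankZeroTwistOdd.missingPPartAt_iff_lower
    (hDel : Delbourgo1998.prop4_rankZero_pow_dvd_constantCoeff)
    (hGZK : rank_eq_analyticRank_of_analyticRank_le_one) (hmod : hasEntireLFunction_rat)
    (hBC : ChiBranchLeadingTermOddAt W p)
    (hp4 : p % 4 = 3) (hr : W.analyticRank = 0) (hX : ClassX3 W p)
    (V : WeierstrassCurve ℚ) [V.IsElliptic] [V.IsGloballyMinimal]
    (C : VariableChange ℚ) (hC : C • V.quadraticTwist (-(p : ℚ)) = W) (hV : GoodOrd V p ∨ Mult V p)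
    {N : ℕ} [NeZero N] {f : CuspForm (Gamma0 N) 2} (hf : IsNewformOf V f)
    (ϖ : ℚ) (hϖ : (ϖ : ℝ) * V.imaginaryPeriodRat = minusPeriod f)
    (htam : ¬ p ∣ W.tamagawaNumberAt ((primesEquiv (R := 𝓞 ℚ)).symm ⟨p, hp.out⟩)) :
    X3.MissingInputAt W p ↔ MissingLowerBoundAt W p :=
  ⟨fun h ↦ (lower_and_upper_of_missingPPartAt W p h).1, fun h ↦
    missingPPartAt_of_lower_of_upper W p h
      (X3RankZeroTwistOdd.missingUpperBoundAt W p hDel hGZK hmod hBC hp4 hr hX V C hC hV hf ϖ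
        hϖ htam)⟩

end AssemblyOdd

end Summit.BirchSwinnertonDyer.Rank1Residual.Additive

end
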